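import Summits.AtomisticToContinuum.Crystallization.Theorems.ExcessDecayLiouvilleHcpLiouvilleLinearEq
import Summits.AtomisticToContinuum.Crystallization.Theorems.ExcessDecayLiouvilleHcpLiouvilleBlowdownDefs

/-!
# `ExcessDecayLiouville.HcpLiouville` (stmt-AtomisticToContinuum-9332), line `Sketch` (skeleton v4): stub `stub_remainder`, part 1

First helper file of stub `stub_remainder` (interface `Blowdown.RemainderProp` of the blow-down): the POINTWISE
bound of the Taylor remainder of the Lennard-Jones pair force and the EXACT linearised equation.

* `Blowdown.remainder_bond_bounds`, `Blowdown.remainder_scalar_bound` — bond geometry and scalar bookkeeping for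
  `‖e‖ ≥ 23/25`, `‖d‖ ≤ 3/20` (lower bound `m = (2/3)‖e‖²` for `‖e + θd‖²`, `|‖e+d‖² − ‖e‖²| ≤ (11/5)‖e‖‖d‖`);
* `Blowdown.norm_ljRemainder_le` — `‖N(e, d)‖ ≤ 25000 · ‖e‖⁻⁹ · ‖d‖²` for `‖e‖ ≥ 23/25`, `‖d‖ ≤ 3/20`
  (`N = Blowdown.ljRemainder`, same proof as `norm_ljForce_linearisation_le` with the new constants);
* `Blowdown.ljRemainder_zero_zero`, `Blowdown.ljRemainder_neg_neg` — `N(0,0) = 0`, `N(−e,−d) = −N(e,d)`;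
* `Blowdown.hasSum_linearised` — part (i) of `RemainderProp`: for the equilibrium `X` in displacement form over the
  anchored two-lattice `S*` in force balance, row by row `Σ_q (K(p − q)(v p − v q) + N(p − q, v p − v q)) = 0`
  (`HasSum`; force balance of `X` at the particle of `p`, reindexed over `S*` by `LevelOne.bijOn_particle_ne`, minus
  force balance of `S*` at `p`; the summand is `F(e + Dv) − F(e)` by definition of `N`).

All `[folklore]`; a `--supports` helper for item stmt-AtomisticToContinuum-9332, nothing here closes an item.
-/

noncomputable section

namespace Summit.AtomisticToContinuum.Crystallization.Theorems.ExcessDecayLiouville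

open scoped BigOperators Topology Classical InnerProductSpace RealInnerProductSpace
open Literature.MathematicalPhysics.StatisticalMechanics
open Summit.AtomisticToContinuum.Crystallization.Theses.ExcessDecayLiouville
open Summit.AtomisticToContinuum.Crystallization.Theorems.PhononStabilityNegative

namespace Blowdown

open LevelOne

/-! ## The pointwise remainder bound -/

/-- Geometry of a perturbed bond: for `‖e‖ ≥ 23/25` and `‖w‖ ≤ 3/20` (so `92‖w‖ ≤ 15‖e‖`),
`(2/3)‖e‖² ≤ ‖e + w‖²` and `|‖e + w‖² − ‖e‖²| ≤ (11/5)‖e‖‖w‖`. [folklore] -/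
theorem remainder_bond_bounds {e w : EuclideanSpace ℝ (Fin 3)} (he : 23 / 25 ≤ ‖e‖) (hw : ‖w‖ ≤ 3 / 20) :
    2 / 3 * ‖e‖ ^ 2 ≤ ‖e + w‖ ^ 2 ∧ |‖e + w‖ ^ 2 - ‖e‖ ^ 2| ≤ 11 / 5 * ‖e‖ * ‖w‖ := by
  have hw0 : 0 ≤ ‖w‖ := norm_nonneg w
  have he0 : 0 ≤ ‖e‖ := norm_nonneg e
  have hwe : 0 ≤ 15 * ‖e‖ - 92 * ‖w‖ := by linarith
  have hcs : |⟪e, w⟫| ≤ ‖e‖ * ‖w‖ := abs_real_inner_le_norm e w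
  have hsq : ‖e + w‖ ^ 2 = ‖e‖ ^ 2 + 2 * ⟪e, w⟫ + ‖w‖ ^ 2 := norm_add_sq_real e w
  have h1 := (abs_le.1 hcs).1
  have h2 := (abs_le.1 hcs).2
  constructor
  · rw [hsq]
    nlinarith [mul_nonneg he0 hwe, sq_nonneg ‖w‖]
  · rw [hsq, abs_le]
    constructor <;> nlinarith [mul_nonneg hw0 hwe, mul_nonneg he0 hw0]

/-- The scalar bookkeeping behind `norm_ljRemainder_le`: with `E = ‖e‖ ≥ 23/25`, `W = ‖d‖ ≥ 0`, `x = E²`,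
`y = ‖e + d‖²`, `|y − x| ≤ (11/5)EW`, the three remainder coefficients (Taylor of `h` on `[2x/3, ∞)`) add up to
`≤ 25000 E⁻⁹ W²`. [folklore] -/
theorem remainder_scalar_bound {E W y : ℝ} (hE : 23 / 25 ≤ E) (hW0 : 0 ≤ W)
    (hdiff : |y - E ^ 2| ≤ 11 / 5 * E * W) :
    (56 * ((2 / 3 * E ^ 2)⁻¹) ^ 9 + 20 * ((2 / 3 * E ^ 2)⁻¹) ^ 6) * (y - E ^ 2) ^ 2 * E +
        (7 * ((E ^ 2)⁻¹) ^ 8 + 4 * ((E ^ 2)⁻¹) ^ 5) * W ^ 2 * E +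
        (7 * ((2 / 3 * E ^ 2)⁻¹) ^ 8 + 4 * ((2 / 3 * E ^ 2)⁻¹) ^ 5) * |y - E ^ 2| * W ≤
      25000 * (E⁻¹) ^ 9 * W ^ 2 := by
  have hE0 : 0 < E := by linarith
  have hmi : (2 / 3 * E ^ 2)⁻¹ = (3 / 2) * (E⁻¹) ^ 2 := by rw [mul_inv, inv_pow]; norm_num
  have hxi : (E ^ 2)⁻¹ = (E⁻¹) ^ 2 := by rw [inv_pow]
  rw [hmi, hxi]
  set u := E⁻¹ with hu
  have hu0 : 0 < u := inv_pos.2 hE0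
  have hue : u * E = 1 := by rw [hu, inv_mul_cancel₀ hE0.ne']
  have hei : u ≤ 25 / 23 := by
    rw [hu, inv_le_comm₀ hE0 (by norm_num)]; linarith
  have hu15 : u ^ 15 ≤ (25 / 23) ^ 6 * u ^ 9 := by
    have : u ^ 6 ≤ (25 / 23) ^ 6 := pow_le_pow_left₀ hu0.le hei 6
    nlinarith [pow_pos hu0 9]
  have hW2 : 0 ≤ W ^ 2 := sq_nonneg _
  have hyx2 : (y - E ^ 2) ^ 2 ≤ (11 / 5 * E * W) ^ 2 := by
    rw [← sq_abs]; exact pow_le_pow_left₀ (abs_nonneg _) hdiff 2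
  -- powers of u against powers of E
  have e18 : ((3 / 2 : ℝ) * u ^ 2) ^ 9 * E ^ 3 = (3 / 2) ^ 9 * u ^ 15 := by
    have : u ^ 18 * E ^ 3 = u ^ 15 * (u * E) ^ 3 := by ring
    rw [mul_pow, ← pow_mul, show 2 * 9 = 18 by norm_num, mul_assoc, this, hue, one_pow, mul_one]
  have e12 : ((3 / 2 : ℝ) * u ^ 2) ^ 6 * E ^ 3 = (3 / 2) ^ 6 * u ^ 9 := by
    have : u ^ 12 * E ^ 3 = u ^ 9 * (u * E) ^ 3 := by ring
    rw [mul_pow, ← pow_mul, show 2 * 6 = 12 by norm_num, mul_assoc, this, hue, one_pow, mul_one]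
  have e16 : (u ^ 2) ^ 8 * E = u ^ 15 := by
    have : u ^ 16 * E = u ^ 15 * (u * E) := by ring
    rw [← pow_mul, show 2 * 8 = 16 by norm_num, this, hue, mul_one]
  have e10 : (u ^ 2) ^ 5 * E = u ^ 9 := by
    have : u ^ 10 * E = u ^ 9 * (u * E) := by ring
    rw [← pow_mul, show 2 * 5 = 10 by norm_num, this, hue, mul_one]
  have e16' : ((3 / 2 : ℝ) * u ^ 2) ^ 8 * E = (3 / 2) ^ 8 * u ^ 15 := by
    rw [mul_pow, mul_assoc, e16]
  have e10' : ((3 / 2 : ℝ) * u ^ 2) ^ 5 * E = (3 / 2) ^ 5 * u ^ 9 := by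
    rw [mul_pow, mul_assoc, e10]
  -- term A
  have hA : (56 * ((3 / 2) * u ^ 2) ^ 9 + 20 * ((3 / 2) * u ^ 2) ^ 6) * (y - E ^ 2) ^ 2 * E ≤
      20000 * u ^ 9 * W ^ 2 := by
    calc (56 * ((3 / 2) * u ^ 2) ^ 9 + 20 * ((3 / 2) * u ^ 2) ^ 6) * (y - E ^ 2) ^ 2 * E
        ≤ (56 * ((3 / 2) * u ^ 2) ^ 9 + 20 * ((3 / 2) * u ^ 2) ^ 6) * (11 / 5 * E * W) ^ 2 * E := by
          gcongr
      _ = (11 / 5) ^ 2 * W ^ 2 * (56 * (((3 / 2 : ℝ) * u ^ 2) ^ 9 * E ^ 3) +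
            20 * (((3 / 2 : ℝ) * u ^ 2) ^ 6 * E ^ 3)) := by ring
      _ = (11 / 5) ^ 2 * W ^ 2 * (56 * ((3 / 2) ^ 9 * u ^ 15) + 20 * ((3 / 2) ^ 6 * u ^ 9)) := by
          rw [e18, e12]
      _ ≤ (11 / 5) ^ 2 * W ^ 2 * (56 * ((3 / 2) ^ 9 * ((25 / 23) ^ 6 * u ^ 9)) +
            20 * ((3 / 2) ^ 6 * u ^ 9)) := by gcongr
      _ = ((11 / 5) ^ 2 * (56 * (3 / 2) ^ 9 * (25 / 23) ^ 6 + 20 * (3 / 2) ^ 6)) * u ^ 9 * W ^ 2 := by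
          ring
      _ ≤ 20000 * u ^ 9 * W ^ 2 := by gcongr; norm_num
  -- term B
  have hB : (7 * (u ^ 2) ^ 8 + 4 * (u ^ 2) ^ 5) * W ^ 2 * E ≤ 20 * u ^ 9 * W ^ 2 := by
    calc (7 * (u ^ 2) ^ 8 + 4 * (u ^ 2) ^ 5) * W ^ 2 * E
        = W ^ 2 * (7 * ((u ^ 2) ^ 8 * E) + 4 * ((u ^ 2) ^ 5 * E)) := by ring
      _ = W ^ 2 * (7 * u ^ 15 + 4 * u ^ 9) := by rw [e16, e10]
      _ ≤ W ^ 2 * (7 * ((25 / 23) ^ 6 * u ^ 9) + 4 * u ^ 9) := by gcongr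
      _ = (7 * (25 / 23) ^ 6 + 4) * u ^ 9 * W ^ 2 := by ring
      _ ≤ 20 * u ^ 9 * W ^ 2 := by gcongr; norm_num
  -- term C
  have hC : (7 * ((3 / 2) * u ^ 2) ^ 8 + 4 * ((3 / 2) * u ^ 2) ^ 5) * |y - E ^ 2| * W ≤
      1000 * u ^ 9 * W ^ 2 := by
    calc (7 * ((3 / 2) * u ^ 2) ^ 8 + 4 * ((3 / 2) * u ^ 2) ^ 5) * |y - E ^ 2| * W
        ≤ (7 * ((3 / 2) * u ^ 2) ^ 8 + 4 * ((3 / 2) * u ^ 2) ^ 5) * (11 / 5 * E * W) * W := by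
          gcongr
      _ = 11 / 5 * W ^ 2 * (7 * (((3 / 2 : ℝ) * u ^ 2) ^ 8 * E) +
            4 * (((3 / 2 : ℝ) * u ^ 2) ^ 5 * E)) := by ring
      _ = 11 / 5 * W ^ 2 * (7 * ((3 / 2) ^ 8 * u ^ 15) + 4 * ((3 / 2) ^ 5 * u ^ 9)) := by
          rw [e16', e10']
      _ ≤ 11 / 5 * W ^ 2 * (7 * ((3 / 2) ^ 8 * ((25 / 23) ^ 6 * u ^ 9)) + 4 * ((3 / 2) ^ 5 * u ^ 9)) := by
          gcongr
      _ = (11 / 5 * (7 * (3 / 2) ^ 8 * (25 / 23) ^ 6 + 4 * (3 / 2) ^ 5)) * u ^ 9 * W ^ 2 := by ring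
      _ ≤ 1000 * u ^ 9 * W ^ 2 := by gcongr; norm_num
  have hpos : 0 ≤ u ^ 9 * W ^ 2 := by positivity
  nlinarith [hA, hB, hC, hpos]

/-- **Pointwise bound of the pair-force Taylor remainder**: for a bond `e` with `‖e‖ ≥ 23/25` and a relative
displacement `d` with `‖d‖ ≤ 3/20`, `‖N(e, d)‖ = ‖F(e + d) − F(e) − K(e)d‖ ≤ 25000 · ‖e‖⁻⁹ · ‖d‖²`. [folklore] -/
theorem norm_ljRemainder_le {e d : EuclideanSpace ℝ (Fin 3)} (he : 23 / 25 ≤ ‖e‖) (hd : ‖d‖ ≤ 3 / 20) :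
    ‖ljRemainder e d‖ ≤ 25000 * (‖e‖⁻¹) ^ 9 * ‖d‖ ^ 2 := by
  have he0 : 0 < ‖e‖ := by linarith
  have hne : e ≠ 0 := norm_pos_iff.1 he0
  have hned : e + d ≠ 0 := by
    intro h
    have h1 : ‖e‖ ≤ ‖e + d‖ + ‖d‖ := by
      have := norm_sub_le (e + d) d; rwa [add_sub_cancel_right] at this
    rw [h, norm_zero] at h1
    linarith
  unfold ljRemainder ljForce
  rw [ljForce_eq_smul hned, ljForce_eq_smul hne, forceConst_apply]
  have hid := ljForce_taylor_identity e d (fun y => -(y⁻¹) ^ 7 + (y⁻¹) ^ 4)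
    (fun y => 7 * (y⁻¹) ^ 8 - 4 * (y⁻¹) ^ 5)
  rw [hid]
  have hx0 : 0 < ‖e‖ ^ 2 := by positivity
  obtain ⟨hyx, hdiff⟩ := remainder_bond_bounds he hd
  have hm0 : 0 < 2 / 3 * ‖e‖ ^ 2 := by positivity
  have hmx : 2 / 3 * ‖e‖ ^ 2 ≤ ‖e‖ ^ 2 := by nlinarith
  have hT := abs_taylor_h_le hm0 hmx hyx
  have hD := abs_h_sub_h_le hm0 hmx hyx
  have hh'x : |7 * ((‖e‖ ^ 2)⁻¹) ^ 8 - 4 * ((‖e‖ ^ 2)⁻¹) ^ 5| ≤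
      7 * ((‖e‖ ^ 2)⁻¹) ^ 8 + 4 * ((‖e‖ ^ 2)⁻¹) ^ 5 := by
    have h8 : 0 ≤ ((‖e‖ ^ 2)⁻¹) ^ 8 := by positivity
    have h5 : 0 ≤ ((‖e‖ ^ 2)⁻¹) ^ 5 := by positivity
    exact abs_le.2 ⟨by nlinarith, by nlinarith⟩
  have hn1 : ‖((-((‖e + d‖ ^ 2)⁻¹) ^ 7 + ((‖e + d‖ ^ 2)⁻¹) ^ 4) - (-((‖e‖ ^ 2)⁻¹) ^ 7 + ((‖e‖ ^ 2)⁻¹) ^ 4) -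
      (7 * ((‖e‖ ^ 2)⁻¹) ^ 8 - 4 * ((‖e‖ ^ 2)⁻¹) ^ 5) * (‖e + d‖ ^ 2 - ‖e‖ ^ 2)) • e‖ ≤
      (56 * ((2 / 3 * ‖e‖ ^ 2)⁻¹) ^ 9 + 20 * ((2 / 3 * ‖e‖ ^ 2)⁻¹) ^ 6) *
        (‖e + d‖ ^ 2 - ‖e‖ ^ 2) ^ 2 * ‖e‖ := by
    rw [norm_smul, Real.norm_eq_abs]
    exact mul_le_mul_of_nonneg_right hT (norm_nonneg _)
  have hn2 : ‖((7 * ((‖e‖ ^ 2)⁻¹) ^ 8 - 4 * ((‖e‖ ^ 2)⁻¹) ^ 5) * ‖d‖ ^ 2) • e‖ ≤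
      (7 * ((‖e‖ ^ 2)⁻¹) ^ 8 + 4 * ((‖e‖ ^ 2)⁻¹) ^ 5) * ‖d‖ ^ 2 * ‖e‖ := by
    rw [norm_smul, Real.norm_eq_abs, abs_mul, abs_of_nonneg (sq_nonneg ‖d‖)]
    gcongr
  have hn3 : ‖((-((‖e + d‖ ^ 2)⁻¹) ^ 7 + ((‖e + d‖ ^ 2)⁻¹) ^ 4) - (-((‖e‖ ^ 2)⁻¹) ^ 7 + ((‖e‖ ^ 2)⁻¹) ^ 4)) • d‖ ≤
      (7 * ((2 / 3 * ‖e‖ ^ 2)⁻¹) ^ 8 + 4 * ((2 / 3 * ‖e‖ ^ 2)⁻¹) ^ 5) * |‖e + d‖ ^ 2 - ‖e‖ ^ 2| * ‖d‖ := by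
    rw [norm_smul, Real.norm_eq_abs]
    exact mul_le_mul_of_nonneg_right hD (norm_nonneg _)
  refine (norm_add₃_le.trans (add_le_add (add_le_add hn1 hn2) hn3)).trans ?_
  exact remainder_scalar_bound he (norm_nonneg d) hdiff

/-- The remainder vanishes at the origin: `N(0, 0) = 0` (`F(0) = 0` by the junk value `0/0 = 0`, `K(0)0 = 0`).
[folklore] -/
@[simp] theorem ljRemainder_zero_zero : ljRemainder 0 0 = 0 := by
  simp [ljRemainder, ljForce]

/-- The remainder is odd: `N(−e, −d) = −N(e, d)`. [folklore] -/
theorem ljRemainder_neg_neg (e d : EuclideanSpace ℝ (Fin 3)) : ljRemainder (-e) (-d) = -ljRemainder e d := by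
  have hF : ∀ x : EuclideanSpace ℝ (Fin 3), ljForce (-x) = -ljForce x := fun x => by
    simp [ljForce, norm_neg, smul_neg]
  have hK : forceConst (-e) = forceConst e := by
    ext x i
    simp [forceConst_apply, norm_neg, inner_neg_left, smul_neg, neg_smul]
  rw [ljRemainder, ljRemainder, ← neg_add, hF, hF, hK, map_neg]
  abel

/-- Norm form of the oddness on a pair of sites: `‖N(q − p, w q − w p)‖ = ‖N(p − q, w p − w q)‖`. [folklore] -/
theorem norm_ljRemainder_swap (w : EuclideanSpace ℝ (Fin 3) → EuclideanSpace ℝ (Fin 3))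
    (p q : EuclideanSpace ℝ (Fin 3)) :
    ‖ljRemainder (q - p) (w q - w p)‖ = ‖ljRemainder (p - q) (w p - w q)‖ := by
  rw [show q - p = -(p - q) by abel, show w q - w p = -(w p - w q) by abel, ljRemainder_neg_neg, norm_neg]

/-! ## Part (i): the exact linearised equation -/

variable {t : Fin 2 → EuclideanSpace ℝ (Fin 3)} {A : EuclideanSpace ℝ (Fin 3) →L[ℝ] EuclideanSpace ℝ (Fin 3)}
  {τ : EuclideanSpace ℝ (Fin 3)} {X : Set (EuclideanSpace ℝ (Fin 3))}
  {u : EuclideanSpace ℝ (Fin 3) → EuclideanSpace ℝ (Fin 3)}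

/-- **The exact linearised equation.**  For `p ∈ S*`,
`Σ_{q ∈ S*} (K(p − q)(v p − v q) + N(p − q, v p − v q)) = 0` as a `HasSum` (force balance of `X` at the particle
`p + v p`, reindexed over `S*`, minus force balance of `S*` at `p`; the summand is `F((p − q) + (v p − v q)) − F(p − q)`
by definition of `N`, and the diagonal term vanishes). [folklore] -/
theorem hasSum_linearised (hA : Adm₀ A) (hI : Inner₀ t A) (hIτ : Inner₀ (anchorDatum t τ) A)
    (hu : IsDisplacement X t A u) (hEX : Equil₀ X) (hEτ : Equil₀ (Sites₀ (anchorDatum t τ) A))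
    (p : Sites₀ (anchorDatum t τ) A) :
    HasSum (fun q : Sites₀ (anchorDatum t τ) A =>
      forceConst ((p : EuclideanSpace ℝ (Fin 3)) - q) (vField t A τ u p - vField t A τ u q) +
        ljRemainder ((p : EuclideanSpace ℝ (Fin 3)) - q) (vField t A τ u p - vField t A τ u q)) 0 := by
  obtain ⟨p, hp⟩ := p
  dsimp only
  have hB := bijOn_particle_ne hA hI hIτ hu hp
  have hxp : p + vField t A τ u p ∈ X := (bijOn_particle hA hI hIτ hu).mapsTo hp
  -- force balance of `X` at the particle of `p`, reindexed over the anchored sites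
  have h1 := ((hB.equiv _).hasSum_iff (f := fun y : ({y : EuclideanSpace ℝ (Fin 3) |
      y ∈ X ∧ y ≠ p + vField t A τ u p} : Set (EuclideanSpace ℝ (Fin 3))) =>
      (deriv lennardJones (dist (p + vField t A τ u p) y.1) / dist (p + vField t A τ u p) y.1) •
        (p + vField t A τ u p - y.1))).2 (hEX _ hxp)
  -- force balance of `S*` at `p`
  have h2 := hEτ p hp
  have h3 := h1.sub h2
  rw [sub_self] at h3
  set f : EuclideanSpace ℝ (Fin 3) → EuclideanSpace ℝ (Fin 3) := fun q =>
    forceConst (p - q) (vField t A τ u p - vField t A τ u q) +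
      ljRemainder (p - q) (vField t A τ u p - vField t A τ u q) with hf
  have h4 : HasSum (fun q : ({q : EuclideanSpace ℝ (Fin 3) | q ∈ Sites₀ (anchorDatum t τ) A ∧ q ≠ p} :
      Set (EuclideanSpace ℝ (Fin 3))) => f q) 0 := by
    refine h3.congr_fun fun q => ?_
    have hEq : ((hB.equiv _ q : ({y : EuclideanSpace ℝ (Fin 3) | y ∈ X ∧ y ≠ p + vField t A τ u p} :
        Set (EuclideanSpace ℝ (Fin 3)))) : EuclideanSpace ℝ (Fin 3)) = q.1 + vField t A τ u q.1 := rfl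
    have hsplit : p + vField t A τ u p - (q.1 + vField t A τ u q.1) =
        (p - q.1) + (vField t A τ u p - vField t A τ u q.1) := by abel
    simp only [hf, Function.comp_apply, hEq, dist_eq_norm, hsplit, ljRemainder, ljForce]
    abel
  -- pass from `S* ∖ {p}` to `S*`: the diagonal term is `K(0)0 + N(0,0) = 0`
  have h5 : HasSum (Set.indicator {q : EuclideanSpace ℝ (Fin 3) | q ∈ Sites₀ (anchorDatum t τ) A ∧ q ≠ p} f) 0 :=
    (hasSum_subtype_iff_indicator (f := f)
      (s := {q : EuclideanSpace ℝ (Fin 3) | q ∈ Sites₀ (anchorDatum t τ) A ∧ q ≠ p})).1 h4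
  have hind : Set.indicator {q : EuclideanSpace ℝ (Fin 3) | q ∈ Sites₀ (anchorDatum t τ) A ∧ q ≠ p} f =
      Set.indicator (Sites₀ (anchorDatum t τ) A) f := by
    funext q
    by_cases hqp : q = p
    · subst hqp
      have hfq : f q = 0 := by simp [hf]
      rw [Set.indicator_of_notMem (fun h => h.2 rfl), Set.indicator_of_mem hp, hfq]
    · by_cases hq : q ∈ Sites₀ (anchorDatum t τ) A
      · rw [Set.indicator_of_mem (show q ∈ {q : EuclideanSpace ℝ (Fin 3) |
            q ∈ Sites₀ (anchorDatum t τ) A ∧ q ≠ p} from ⟨hq, hqp⟩), Set.indicator_of_mem hq]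
      · rw [Set.indicator_of_notMem (fun h => hq h.1), Set.indicator_of_notMem hq]
  rw [hind] at h5
  exact (hasSum_subtype_iff_indicator (f := f) (s := Sites₀ (anchorDatum t τ) A)).2 h5

end Blowdown

/-- Registered sub-goal carrying this helper file (crux stmt-AtomisticToContinuum-9332, line `Sketch`, skeleton v4,
stub `stub_remainder`, part 1): the pointwise bound of the pair-force Taylor remainder,
`‖N(e, d)‖ ≤ 25000‖e‖⁻⁹‖d‖²` for `‖e‖ ≥ 23/25`, `‖d‖ ≤ 3/20`. [folklore] -/
theorem blowdown_remainderPointwise : ∀ e d : EuclideanSpace ℝ (Fin 3), 23 / 25 ≤ ‖e‖ → ‖d‖ ≤ 3 / 20 →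
    ‖Blowdown.ljRemainder e d‖ ≤ 25000 * (‖e‖⁻¹) ^ 9 * ‖d‖ ^ 2 :=
  fun _ _ he hd => Blowdown.norm_ljRemainder_le he hd

end Summit.AtomisticToContinuum.Crystallization.Theorems.ExcessDecayLiouville

end
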